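import Literature.AlgebraicGeometry.Motives.UniversalHyperplaneSectionSmooth
import Literature.AlgebraicGeometry.Motives.UniversalHyperplaneSectionIrreducible
import Literature.AlgebraicGeometry.Motives.VarietiesGeometricallyIntegralProofs
import HarnessLib

/-!
# The universal hyperplane section of a smooth projective variety is a smooth projective variety

Topic `Literature/AlgebraicGeometry/Motives` (one theorem; no definitions, no named facts).
For a smooth projective geometrically irreducible `k`-variety `X` of dimension `m + 1` and a closed
immersion `ι : X ⟶ ℙᴺ_k` with `N ≥ 2`, the universal hyperplane section
`𝒳 = {(x, a) | Σᵢ aᵢ xᵢ(x) = 0} ⊂ X × (ℙᴺ)^*` (`Motives/UniversalHyperplaneSection`) is a smooth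
projective geometrically irreducible `k`-variety of dimension `m + N`
(`isSmoothProjective_universalHyperplaneSection`): it is smooth of relative dimension
`(N - 1) + (m + 1)` (`UniversalHyperplaneSection.smoothOfRelativeDimension_hom`, the
`ℙᴺ⁻¹`-bundle structure over `X`, Voisin II §2.1.1), projective
(`UniversalHyperplaneSection.isProjectiveOver`) and geometrically irreducible
(`UniversalHyperplaneSection.geometricallyIrreducible_hom`). This is the hypothesis `hU` of the
incidence-divisor descent of `HodgeTheory/PencilStepBelowMiddleProofs`.

## References

* [VoisinHodgeII2003] C. Voisin, Hodge Theory and Complex Algebraic Geometry II, CUP 2003, §2.1.1, §3.2.2.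
* [Hartshorne1977] R. Hartshorne, Algebraic Geometry, II Ex. 4.9, III Prop. 10.1.
-/

noncomputable section

open CategoryTheory AlgebraicGeometry

universe u

namespace Literature.AlgebraicGeometry.Motives

/-- **The universal hyperplane section of a smooth projective variety is smooth projective** of
dimension `m + N` (`X` smooth projective of dimension `m + 1`, `ι : X ⟶ ℙᴺ` a closed immersion,
`N ≥ 2`): smooth of relative dimension `(N - 1) + (m + 1)` as a `ℙᴺ⁻¹`-bundle over `X`, projective
inside `X × (ℙᴺ)^*`, geometrically irreducible. [cite: VoisinHodgeII2003, §2.1.1 and §3.2.2]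
[cite: Hartshorne1977, III Prop. 10.1 (c) and II Ex. 4.9] -/
theorem isSmoothProjective_universalHyperplaneSection {k : Type u} [Field k] {m N : ℕ}
    {X : SchemeOver k} (hX : IsSmoothProjective (m + 1) X) (ι : X ⟶ projectiveSpace N k)
    [IsClosedImmersion ι.left] (hN : 2 ≤ N) :
    IsSmoothProjective (m + N) (universalHyperplaneSection N ι) := by
  haveI := hX.smoothOfRelativeDimension
  haveI := hX.geometricallyIrreducible
  haveI : IsIntegral X.left := IsSmoothProjective.isIntegral_holds hX
  refine ⟨?_, UniversalHyperplaneSection.isProjectiveOver N ι hX.isProjectiveOver,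
    UniversalHyperplaneSection.geometricallyIrreducible_hom ι hN⟩
  have h := UniversalHyperplaneSection.smoothOfRelativeDimension_hom ι (m + 1)
  rwa [show N - 1 + (m + 1) = m + N by omega] at h

end Literature.AlgebraicGeometry.Motives

end
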